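import Summits.CriticalPhenomena.PercolationContinuityZ3.Theorems.PercTorusSliceFillingNoCriticalTorusGiantNecessity
import Literature.Probability.Percolation.BondPercolationBlockIndependence
import HarnessLib

/-!
# `stub_localCountChebyshev` (F1a) of line `registered` (crux `NoCriticalTorusGiant`,
# stmt-CriticalPhenomena-5407): Chebyshev bound for the number of vertices in `m`-large clusters

Registered stub `stub_localCountChebyshev` of the lead's skeleton
`Cruxes/NoCriticalTorusGiant/Lines/birth.lean` (reshape c3, side stub F1a).

Statement: for Bernoulli bond percolation on the discrete torus `T_n = (ℤ/nℤ)³` (`torusGraph 3 n`)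
at ANY edge density `p`, every `m, n` with `4m + 4 ≤ n` and every `η > 0`,

  `P_{T_n,p}( #{x : |C(x)| ≥ m+1} ≥ (θ_{m+1} + η) n³ ) ≤ (4m+3)³ / (η² n³)`,

where `θ_{m+1} = P_{ℤ³,p}(|C(0)| ≥ m+1)` (`clusterSizeGe`).

Proof (second-moment version of `real_clusterSize_torus_le_zd` of the Necessity file).
* Local indicators. For a torus vertex `x` let `A x` be the event that the local cluster of `0`
  in the configuration lifted along the box chart `a ↦ x + proj a` of `B(m)` has `≥ m + 1`
  vertices. Almost surely (only torus edges open) `1{|C(x)| ≥ m+1} ≤ 1_{A x}`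
  (`Necessity.succ_le_ncard_locCluster`), so the count is at most `Σ_x 1_{A x}`.
* Mean. `P(A x) = θloc := P_{ℤ³,p}`(local box cluster of `0` has `≥ m+1` vertices) `≤ θ_{m+1}`
  (same local law `map_restrictConfig_chart_eq`, `Necessity.mem_clusterSizeGe_of_succ_le_ncard`).
* Local dependence. `A x` is determined by the chart-image edges `range (Sym2.map chart_x)`
  (`F1a.determinedBy_preimage_restrictConfig`); if `x' ∉ x + proj B(2m)` the two image edge
  sets are disjoint (`F1a.disjoint_range_chart`), so `P(A x ∩ A x') = P(A x) P(A x')`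
  (`bondPercolation_real_inter_of_disjoint`), and `#(x + proj B(2m)) ≤ (4m+1)³` (`card_box`).
* Chebyshev for locally dependent indicators (`F1a.measureReal_sum_indicator_sub_le`, abstract):
  with `D = Σ_x (1_{A x} - θloc)`, `E[D²] = Σ_x Σ_{x'} (P(A x ∩ A x') - θloc²) ≤ n³ (4m+1)³`
  (far pairs vanish, near pairs are `≤ 1`), and Markov for `D²` on `{D ≥ η n³}`.
Mathlib + the tree only.
-/

noncomputable section

namespace Summit.CriticalPhenomena.PercolationContinuityZ3.Theorems.PercTorusSliceFillingNoCriticalTorusGiant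

open MeasureTheory ProbabilityTheory Filter Topology
open Literature.Probability.Percolation Literature.Probability.LatticeModels
open Summit.CriticalPhenomena.PercolationContinuityZ3.Theorems.SliceFillingTransportProof
open scoped Classical

namespace F1a

/-! ## Chebyshev for sums of locally dependent indicators (abstract) -/

section Abstract

variable {Ω ι : Type*} [MeasurableSpace Ω]

/-- **Chebyshev for locally dependent indicators.** Let `A i`, `i : ι` (finite), be events of a
probability space, all of probability `θ`, and suppose each `A i` is independent of `A j` for
all `j` outside an exceptional set `N i` of cardinality `≤ K`. Then for `t > 0`,
`P( Σ_i (1_{A i} - θ) ≥ t ) ≤ |ι| K / t²`: the second moment of `D = Σ_i (1_{A i} - θ)` is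
`Σ_i Σ_j (P(A i ∩ A j) - θ²)`, far pairs contribute `0` and near pairs at most `1`; Markov for
`D²`. -/
theorem measureReal_sum_indicator_sub_le [Fintype ι] (μ : Measure Ω) [IsProbabilityMeasure μ]
    (A : ι → Set Ω) (hAm : ∀ i, MeasurableSet (A i)) (θ : ℝ) (hA : ∀ i, μ.real (A i) = θ)
    (N : ι → Finset ι) (K : ℕ) (hN : ∀ i, (N i).card ≤ K)
    (hfar : ∀ i j, j ∉ N i → μ.real (A i ∩ A j) = μ.real (A i) * μ.real (A j))
    {t : ℝ} (ht : 0 < t) :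
    μ.real {ω | t ≤ ∑ i, ((A i).indicator 1 ω - θ)} ≤ Fintype.card ι * K / t ^ 2 := by
  -- the centred indicators
  set f : ι → Ω → ℝ := fun i ω => (A i).indicator 1 ω - θ with hf
  have hind : ∀ i, Integrable (fun ω => (A i).indicator (1 : Ω → ℝ) ω) μ := fun i =>
    (integrable_const (1 : ℝ)).indicator (hAm i)
  have hfi : ∀ i, Integrable (f i) μ := fun i => (hind i).sub (integrable_const θ)
  have hfb : ∀ i ω, ‖f i ω‖ ≤ 1 + |θ| := by
    intro i ω
    rw [Real.norm_eq_abs]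
    refine (abs_sub _ _).trans ?_
    gcongr
    simp only [Set.indicator_apply, Pi.one_apply]
    split_ifs <;> simp
  have hff : ∀ i j, Integrable (fun ω => f i ω * f j ω) μ := fun i j =>
    (hfi j).bdd_mul (hfi i).aestronglyMeasurable (ae_of_all _ (hfb i))
  -- the product integrals
  have hprod : ∀ i j, ∫ ω, f i ω * f j ω ∂μ =
      μ.real (A i ∩ A j) - θ * μ.real (A j) - θ * μ.real (A i) + θ ^ 2 := by
    intro i j
    have heq : (fun ω => f i ω * f j ω) = fun ω =>
        (A i ∩ A j).indicator 1 ω - θ * (A j).indicator 1 ω - θ * (A i).indicator 1 ω + θ ^ 2 := by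
      funext ω
      simp only [hf, Set.indicator_apply, Set.mem_inter_iff, Pi.one_apply]
      by_cases hi : ω ∈ A i <;> by_cases hj : ω ∈ A j <;> simp [hi, hj] <;> ring
    have h1 : Integrable (fun ω => (A i ∩ A j).indicator (1 : Ω → ℝ) ω) μ :=
      (integrable_const (1 : ℝ)).indicator ((hAm i).inter (hAm j))
    have h2 : Integrable (fun ω => θ * (A j).indicator (1 : Ω → ℝ) ω) μ := (hind j).const_mul θ
    have h3 : Integrable (fun ω => θ * (A i).indicator (1 : Ω → ℝ) ω) μ := (hind i).const_mul θ
    have h12 : Integrable (fun ω => (A i ∩ A j).indicator (1 : Ω → ℝ) ω -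
        θ * (A j).indicator (1 : Ω → ℝ) ω) μ := h1.sub h2
    have h123 : Integrable (fun ω => (A i ∩ A j).indicator (1 : Ω → ℝ) ω -
        θ * (A j).indicator (1 : Ω → ℝ) ω - θ * (A i).indicator (1 : Ω → ℝ) ω) μ := h12.sub h3
    rw [heq, integral_add h123 (integrable_const _), integral_sub h12 h3,
      integral_sub h1 h2, integral_const_mul, integral_const_mul, integral_indicator_one (hAm i),
      integral_indicator_one (hAm j), integral_indicator_one ((hAm i).inter (hAm j)),
      integral_const, probReal_univ, one_smul]
  -- far pairs vanish, near pairs are at most `1`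
  have hzero : ∀ i j, j ∉ N i → ∫ ω, f i ω * f j ω ∂μ = 0 := by
    intro i j hj
    rw [hprod, hfar i j hj, hA i, hA j]
    ring
  have hone : ∀ i j, ∫ ω, f i ω * f j ω ∂μ ≤ 1 := by
    intro i j
    rw [hprod, hA i, hA j]
    have h1 : μ.real (A i ∩ A j) ≤ 1 := measureReal_le_one
    nlinarith [sq_nonneg θ]
  -- the second moment of `D = Σ_i f i`
  set D : Ω → ℝ := fun ω => ∑ i, f i ω with hD
  have hD2 : (fun ω => D ω ^ 2) = fun ω => ∑ i, ∑ j, f i ω * f j ω := by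
    funext ω
    rw [sq, hD, Finset.sum_mul_sum]
  have hD2i : Integrable (fun ω => D ω ^ 2) μ := by
    rw [hD2]
    exact integrable_finsetSum _ fun i _ => integrable_finsetSum _ fun j _ => hff i j
  have hED2 : ∫ ω, D ω ^ 2 ∂μ ≤ Fintype.card ι * K := by
    rw [hD2, integral_finsetSum _ (fun i _ => integrable_finsetSum _ fun j _ => hff i j)]
    calc ∑ i, ∫ ω, ∑ j, f i ω * f j ω ∂μ
        = ∑ i, ∑ j, ∫ ω, f i ω * f j ω ∂μ :=
          Finset.sum_congr rfl fun i _ => integral_finsetSum _ fun j _ => hff i j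
      _ ≤ ∑ _i : ι, (K : ℝ) := Finset.sum_le_sum fun i _ => ?_
      _ = Fintype.card ι * K := by rw [Finset.sum_const, Finset.card_univ, nsmul_eq_mul]
    calc ∑ j, ∫ ω, f i ω * f j ω ∂μ
        = ∑ j, (if j ∈ N i then ∫ ω, f i ω * f j ω ∂μ else 0) :=
          Finset.sum_congr rfl fun j _ => by
            split_ifs with h
            · rfl
            · exact hzero i j h
      _ ≤ ∑ j, (if j ∈ N i then (1 : ℝ) else 0) := Finset.sum_le_sum fun j _ => by
            split_ifs
            · exact hone i j
            · exact le_rfl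
      _ = ((Finset.univ.filter fun j => j ∈ N i).card : ℝ) := by rw [Finset.sum_boole]
      _ ≤ (N i).card := by
          exact_mod_cast Finset.card_le_card fun j hj => (Finset.mem_filter.1 hj).2
      _ ≤ K := by exact_mod_cast hN i
  -- Markov for `D²`
  have hsub : {ω | t ≤ ∑ i, ((A i).indicator 1 ω - θ)} ⊆ {ω | t ^ 2 ≤ D ω ^ 2} :=
    fun ω hω => pow_le_pow_left₀ ht.le hω 2
  have hmarkov := mul_meas_ge_le_integral_of_nonneg (ae_of_all μ fun ω => sq_nonneg (D ω)) hD2i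
    (t ^ 2)
  have ht2 : 0 < t ^ 2 := pow_pos ht 2
  calc μ.real {ω | t ≤ ∑ i, ((A i).indicator 1 ω - θ)}
      ≤ μ.real {ω | t ^ 2 ≤ D ω ^ 2} := measureReal_mono hsub (measure_ne_top _ _)
    _ ≤ (∫ ω, D ω ^ 2 ∂μ) / t ^ 2 := by
        rw [le_div_iff₀ ht2, mul_comm]
        exact hmarkov
    _ ≤ Fintype.card ι * K / t ^ 2 := div_le_div_of_nonneg_right hED2 ht2.le

end Abstract

/-! ## Locality of the lifted configuration -/

section Locality

variable {V W : Type*}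

/-- The configuration restricted along `f : W → V` reads only the image edges
`range (Sym2.map f)`. -/
theorem restrictConfig_inter_range (f : W → V) (ω : BondConfig V) :
    restrictConfig f (ω ∩ Set.range (Sym2.map f)) = restrictConfig f ω := by
  ext e
  simp only [mem_restrictConfig, Set.mem_inter_iff, Set.mem_range, exists_apply_eq_apply, and_true]

/-- An event of the restricted configuration is determined by the image edges
`range (Sym2.map f)`. -/
theorem determinedBy_preimage_restrictConfig (f : W → V) (B : Set (BondConfig W)) :
    DeterminedBy (restrictConfig f ⁻¹' B) (Set.range (Sym2.map f)) := by
  rw [determinedBy_iff]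
  intro ω ω' h
  simp only [Set.mem_preimage]
  rw [← restrictConfig_inter_range f ω, h, restrictConfig_inter_range]

end Locality

/-! ## Geometry: charts of `∞`-distant vertices have disjoint edge sets -/

variable {n m : ℕ}

/-- `Torus.proj` of a difference (on `ℤ³`). -/
theorem proj_sub_site3 (n : ℕ) (a b : Site 3) :
    Torus.proj n (a - b) = Torus.proj n a - Torus.proj n b := by
  ext i; simp [Torus.proj_apply]

/-- If `x' ∉ x + proj B(2m)`, the chart images of the edges of `B(m)` around `x` and around `x'`
are disjoint: a common edge would have an endpoint `x + proj a = x' + proj c` with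
`a, c ∈ B(m)`, whence `x' = x + proj (a - c)` with `a - c ∈ B(2m)`. -/
theorem disjoint_range_chart (x x' : TorusSite 3 n)
    (hx' : x' ∉ (box 3 (2 * m)).image fun z : Site 3 => x + Torus.proj n z) :
    Disjoint (Set.range (Sym2.map fun a : (box 3 m : Set (Site 3)) => x + Torus.proj n (a : Site 3)))
      (Set.range (Sym2.map fun a : (box 3 m : Set (Site 3)) => x' + Torus.proj n (a : Site 3))) := by
  rw [Set.disjoint_left]
  rintro e ⟨e₁, rfl⟩ ⟨e₂, he₂⟩
  induction e₁ using Sym2.ind with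
  | h a b =>
    have ha : x + Torus.proj n (a : Site 3) ∈
        Sym2.map (fun a : (box 3 m : Set (Site 3)) => x' + Torus.proj n (a : Site 3)) e₂ := by
      rw [he₂, Sym2.map_mk]
      exact Sym2.mem_mk_left _ _
    obtain ⟨c, -, hc⟩ := Sym2.mem_map.1 ha
    apply hx'
    rw [Finset.mem_image]
    refine ⟨(a : Site 3) - c, ?_, ?_⟩
    · rw [mem_box]
      intro i
      have h1 := abs_le_of_mem_box a.2 i
      have h2 := abs_le_of_mem_box c.2 i
      rw [abs_le] at h1 h2
      rw [Pi.sub_apply]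
      push_cast
      constructor <;> linarith
    · rw [proj_sub_site3]
      calc x + (Torus.proj n (a : Site 3) - Torus.proj n (c : Site 3))
          = (x + Torus.proj n (a : Site 3)) - Torus.proj n (c : Site 3) := by abel
        _ = (x' + Torus.proj n (c : Site 3)) - Torus.proj n (c : Site 3) := by rw [hc]
        _ = x' := by abel

/-- The exceptional set `x + proj B(2m)` has at most `(4m+1)³` elements (`card_box`). -/
theorem card_image_box_le (x : TorusSite 3 n) :
    ((box 3 (2 * m)).image fun z : Site 3 => x + Torus.proj n z).card ≤ (4 * m + 1) ^ 3 := by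
  refine Finset.card_image_le.trans ?_
  rw [card_box]
  apply Nat.pow_le_pow_left
  omega

/-- **Far local events are independent.** Events of the configurations lifted along the charts
around `x` and `x'` with `x' ∉ x + proj B(2m)` are independent under `P_{T_n,p}` (disjoint
determining edge sets, `bondPercolation_real_inter_of_disjoint`). -/
theorem measureReal_inter_chart_eq [NeZero n] (p : unitInterval)
    (B B' : Set (BondConfig (box 3 m : Set (Site 3)))) (x x' : TorusSite 3 n)
    (hx' : x' ∉ (box 3 (2 * m)).image fun z : Site 3 => x + Torus.proj n z) :
    (bondPercolation (torusGraph 3 n) p).real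
        (restrictConfig (fun a : (box 3 m : Set (Site 3)) => x + Torus.proj n (a : Site 3)) ⁻¹' B ∩
          restrictConfig (fun a : (box 3 m : Set (Site 3)) => x' + Torus.proj n (a : Site 3)) ⁻¹' B') =
      (bondPercolation (torusGraph 3 n) p).real
          (restrictConfig (fun a : (box 3 m : Set (Site 3)) => x + Torus.proj n (a : Site 3)) ⁻¹' B) *
        (bondPercolation (torusGraph 3 n) p).real
          (restrictConfig (fun a : (box 3 m : Set (Site 3)) => x' + Torus.proj n (a : Site 3)) ⁻¹' B') :=
  bondPercolation_real_inter_of_disjoint (torusGraph 3 n) p (disjoint_range_chart x x' hx')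
    (determinedBy_preimage_restrictConfig _ B) (determinedBy_preimage_restrictConfig _ B')
    MeasurableSet.of_discrete MeasurableSet.of_discrete

/-! ## The count is dominated by the sum of the local indicators -/

/-- For a finite type, `ncard {x | P x} = Σ_x 1{P x}` (as a real number). -/
theorem ncard_setOf_eq_sum_ite {α : Type*} [Fintype α] (P : α → Prop) :
    (({x : α | P x}.ncard : ℕ) : ℝ) = ∑ x : α, (if P x then (1 : ℝ) else 0) := by
  rw [Finset.sum_boole]
  congr 1
  rw [← Set.ncard_coe_finset]
  congr 1
  ext x
  simp

end F1a

/-- **Stub F1a — Chebyshev bound for the number of vertices in `m`-large clusters (every `p`).**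
For `4m + 4 ≤ n` and `η > 0`,
`P_{T_n,p}(#{x : |C(x)| ≥ m+1} ≥ (P_{ℤ³,p}(|C(0)| ≥ m+1) + η) · n³) ≤ (4m+3)³ / (η² n³)`.
Proof: a.s. (only torus edges open) `1{|C(x)| ≥ m+1} ≤ 1_{A x}`, the indicator that the local
cluster of `0` in the configuration lifted along the chart `a ↦ x + proj a` of `B(m)` has `≥ m+1`
vertices (`Necessity.succ_le_ncard_locCluster`); `A x` is determined by the torus edges inside
`x + proj B(m)`, has probability `P_{ℤ³,p}`(local box cluster of `0` has `≥ m+1` vertices)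
`≤ P_{ℤ³,p}(|C(0)| ≥ m+1)` (`map_restrictConfig_chart_eq`,
`Necessity.mem_clusterSizeGe_of_succ_le_ncard`), and `A x, A x'` are independent unless
`x' - x ∈ proj B(2m)` (`F1a.measureReal_inter_chart_eq`), so the abstract Chebyshev bound
`F1a.measureReal_sum_indicator_sub_le` applies with `K = (4m+1)³`, `t = η n³`. -/
theorem stub_localCountChebyshev : ∀ (p : unitInterval) (n m : ℕ) (η : ℝ), 0 < η → 4 * m + 4 ≤ n → (bondPercolation (torusGraph 3 n) p).real {ω | ((bondPercolation (zdGraph 3) p).real (clusterSizeGe (0 : Site 3) (m + 1)) + η) * (n : ℝ) ^ 3 ≤ (({x : TorusSite 3 n | m + 1 ≤ (openCluster ω x).ncard}.ncard : ℕ) : ℝ)} ≤ (4 * (m : ℝ) + 3) ^ 3 / (η ^ 2 * (n : ℝ) ^ 3) := by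
  intro p n m η hη hn
  have hn2 : 2 * m + 2 ≤ n := by omega
  haveI : NeZero n := ⟨by omega⟩
  set μT := bondPercolation (torusGraph 3 n) p with hμT
  set μZ := bondPercolation (zdGraph 3) p with hμZ
  set θ := μZ.real (clusterSizeGe (0 : Site 3) (m + 1)) with hθ
  -- the local event and its lifts
  set B : Set (BondConfig (box 3 m : Set (Site 3))) := {η' | m + 1 ≤ Set.ncard
    {b : (box 3 m : Set (Site 3)) | (openGraph η').Reachable ⟨0, zero_mem_boxSet m⟩ b}} with hB
  set A : TorusSite 3 n → Set (BondConfig (TorusSite 3 n)) := fun x =>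
    restrictConfig (fun a : (box 3 m : Set (Site 3)) => x + Torus.proj n (a : Site 3)) ⁻¹' B with hA
  set θloc := μZ.real (restrictConfig (Subtype.val : (box 3 m : Set (Site 3)) → Site 3) ⁻¹' B)
    with hθloc
  -- mean: same local law, and `θloc ≤ θ`
  have hAθ : ∀ x, μT.real (A x) = θloc := by
    intro x
    simp only [hA, hθloc]
    rw [← map_measureReal_apply (measurable_restrictConfig _) MeasurableSet.of_discrete,
      ← map_measureReal_apply (measurable_restrictConfig _) MeasurableSet.of_discrete,
      hμT, hμZ, map_restrictConfig_chart_eq hn2 x p]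
  have hθle : θloc ≤ θ :=
    measureReal_mono (fun ω hω => Necessity.mem_clusterSizeGe_of_succ_le_ncard hω)
      (measure_ne_top _ _)
  -- local dependence
  set N : TorusSite 3 n → Finset (TorusSite 3 n) := fun x =>
    (box 3 (2 * m)).image fun z : Site 3 => x + Torus.proj n z with hN
  have hNcard : ∀ x, (N x).card ≤ (4 * m + 1) ^ 3 := fun x => F1a.card_image_box_le x
  have hfar : ∀ x x', x' ∉ N x → μT.real (A x ∩ A x') = μT.real (A x) * μT.real (A x') :=
    fun x x' hx' => F1a.measureReal_inter_chart_eq p B B x x' hx'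
  -- Chebyshev for the centred local indicators
  have hn0 : (0 : ℝ) < n := by exact_mod_cast (show 0 < n by omega)
  have ht : 0 < η * (n : ℝ) ^ 3 := mul_pos hη (pow_pos hn0 3)
  have hcheb := F1a.measureReal_sum_indicator_sub_le μT A (fun _ => MeasurableSet.of_discrete)
    θloc hAθ N ((4 * m + 1) ^ 3) hNcard hfar ht
  -- almost surely only torus edges are open
  have hnullT : μT.real {ω : BondConfig (TorusSite 3 n) | ¬ ω ⊆ (torusGraph 3 n).edgeSet} = 0 := by
    have h := setBernoulli_ae_subset (u := (torusGraph 3 n).edgeSet) (p := p)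
    rw [measureReal_eq_zero_iff]
    exact ae_iff.1 h
  -- pointwise: on the event, `Σ_x (1_{A x} - θloc) ≥ η n³`
  have hcard : (Fintype.card (TorusSite 3 n) : ℝ) = (n : ℝ) ^ 3 := by
    rw [Fintype.card_fun, ZMod.card, Fintype.card_fin, Nat.cast_pow]
  have hcover : {ω : BondConfig (TorusSite 3 n) | (θ + η) * (n : ℝ) ^ 3 ≤
      (({x : TorusSite 3 n | m + 1 ≤ (openCluster ω x).ncard}.ncard : ℕ) : ℝ)} ∩
        {ω | ω ⊆ (torusGraph 3 n).edgeSet} ⊆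
      {ω | η * (n : ℝ) ^ 3 ≤ ∑ x, ((A x).indicator 1 ω - θloc)} := by
    rintro ω ⟨hω, hωE⟩
    have hω' : (θ + η) * (n : ℝ) ^ 3 ≤
        (({x : TorusSite 3 n | m + 1 ≤ (openCluster ω x).ncard}.ncard : ℕ) : ℝ) := hω
    have hωE' : ω ⊆ (torusGraph 3 n).edgeSet := hωE
    have h1 : (({x : TorusSite 3 n | m + 1 ≤ (openCluster ω x).ncard}.ncard : ℕ) : ℝ) ≤
        ∑ x, (A x).indicator (1 : BondConfig (TorusSite 3 n) → ℝ) ω := by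
      have hsub : {x : TorusSite 3 n | m + 1 ≤ (openCluster ω x).ncard} ⊆ {x | ω ∈ A x} :=
        fun x hx => Necessity.succ_le_ncard_locCluster hn2 x hωE' hx
      calc (({x : TorusSite 3 n | m + 1 ≤ (openCluster ω x).ncard}.ncard : ℕ) : ℝ)
          ≤ (({x : TorusSite 3 n | ω ∈ A x}.ncard : ℕ) : ℝ) := by
            exact_mod_cast Set.ncard_le_ncard hsub (Set.toFinite _)
        _ = ∑ x, (if ω ∈ A x then (1 : ℝ) else 0) := F1a.ncard_setOf_eq_sum_ite _
        _ = ∑ x, (A x).indicator (1 : BondConfig (TorusSite 3 n) → ℝ) ω :=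
            Finset.sum_congr rfl fun x _ => by rw [Set.indicator_apply, Pi.one_apply]
    have h2 : ∑ x, ((A x).indicator (1 : BondConfig (TorusSite 3 n) → ℝ) ω - θloc) =
        ∑ x, (A x).indicator (1 : BondConfig (TorusSite 3 n) → ℝ) ω - (n : ℝ) ^ 3 * θloc := by
      rw [Finset.sum_sub_distrib, Finset.sum_const, Finset.card_univ, nsmul_eq_mul, hcard]
    show η * (n : ℝ) ^ 3 ≤ ∑ x, ((A x).indicator 1 ω - θloc)
    rw [h2]
    have h3 : (n : ℝ) ^ 3 * θloc ≤ (n : ℝ) ^ 3 * θ := by gcongr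
    linarith [hω', h1, h3]
  -- assemble
  calc μT.real {ω | (θ + η) * (n : ℝ) ^ 3 ≤
        (({x : TorusSite 3 n | m + 1 ≤ (openCluster ω x).ncard}.ncard : ℕ) : ℝ)}
      ≤ μT.real ({ω : BondConfig (TorusSite 3 n) | (θ + η) * (n : ℝ) ^ 3 ≤
            (({x : TorusSite 3 n | m + 1 ≤ (openCluster ω x).ncard}.ncard : ℕ) : ℝ)} ∩
            {ω | ω ⊆ (torusGraph 3 n).edgeSet} ∪
          {ω | ¬ ω ⊆ (torusGraph 3 n).edgeSet}) :=
        measureReal_mono (fun ω hω => by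
          by_cases h : ω ⊆ (torusGraph 3 n).edgeSet
          · exact Or.inl ⟨hω, h⟩
          · exact Or.inr h) (measure_ne_top _ _)
    _ ≤ μT.real ({ω : BondConfig (TorusSite 3 n) | (θ + η) * (n : ℝ) ^ 3 ≤
            (({x : TorusSite 3 n | m + 1 ≤ (openCluster ω x).ncard}.ncard : ℕ) : ℝ)} ∩
            {ω | ω ⊆ (torusGraph 3 n).edgeSet}) +
          μT.real {ω | ¬ ω ⊆ (torusGraph 3 n).edgeSet} :=
        measureReal_union_le _ _
    _ = μT.real ({ω : BondConfig (TorusSite 3 n) | (θ + η) * (n : ℝ) ^ 3 ≤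
            (({x : TorusSite 3 n | m + 1 ≤ (openCluster ω x).ncard}.ncard : ℕ) : ℝ)} ∩
            {ω | ω ⊆ (torusGraph 3 n).edgeSet}) := by rw [hnullT, add_zero]
    _ ≤ μT.real {ω | η * (n : ℝ) ^ 3 ≤ ∑ x, ((A x).indicator 1 ω - θloc)} :=
        measureReal_mono hcover (measure_ne_top _ _)
    _ ≤ Fintype.card (TorusSite 3 n) * (((4 * m + 1) ^ 3 : ℕ) : ℝ) / (η * (n : ℝ) ^ 3) ^ 2 :=
        hcheb
    _ = (4 * (m : ℝ) + 1) ^ 3 / (η ^ 2 * (n : ℝ) ^ 3) := by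
        rw [hcard]
        push_cast
        field_simp
    _ ≤ (4 * (m : ℝ) + 3) ^ 3 / (η ^ 2 * (n : ℝ) ^ 3) := by
        gcongr
        norm_num

end Summit.CriticalPhenomena.PercolationContinuityZ3.Theorems.PercTorusSliceFillingNoCriticalTorusGiant
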